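import Literature.NumberTheory.EllipticCurves.CyclotomicLayerPairingOfFunMackey
import Literature.NumberTheory.GaloisRepresentations.ContinuousShapiroLiftMackeyH1
import HarnessLib

/-!
# The local term at a finite place `v` of `θ_v^*(Sh_{Γ_n} a) ∪_{Σe} u` for an ARBITRARY LOCAL class
# `u ∈ H¹(ℚ_v, Maps(Γ_ℚ ⧸ Γ_n, M))`: `inv_v(θ_v^*(Sh a) ∪ u) = Σ_i ⟨loc_n(g_i · a), b_i⟩_{n,N,v}` with `Sh^{Γ_v}(b_i) = H¹(Φ_{g_iΓ_n}) u`
# — the arbitrary-second-factor sibling of `CyclotomicLayerPairingOfFunMackey.lean`, and local classes with PRESCRIBED place components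

Topic `NumberTheory/EllipticCurves`, sub-namespace `CyclotomicLayer` (as `CyclotomicLayerPairingOfFun{,Mackey}.lean`). THEOREMS ONLY
(no definition, no named fact, no instance, no `sorry`). Same data as the companion: a finite discrete `Γ_ℚ`-module `M` with a pairing
`e : M × M → μ_N` (`contPairingOfFun`), the `ℤ_p`-tower `κ`, a layer `Γ_n = κ.layerSubgroup n`, a finite place `v`, `θ = resGalOfEmb
(closureEmb ℚ_v) : Γ_v → Γ_ℚ`, `U_n = layerGroup κ v n = θ⁻¹Γ_n`, orbit representatives `g : ι → Γ_ℚ` of the `Γ_v`-action on `Γ_ℚ ⧸ Γ_n`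
(`hbij`; they EXIST: `exists_orbitReps_bijective`; `#ι` = number of places of `ℚ_n` above `v`).

* **`invAt_cupProduct_map_shapiroLift_eq_sum`** — for `a ∈ H¹(Γ_n, M)`, an ARBITRARY `u ∈ H¹(Γ_v, Maps(Γ_ℚ ⧸ Γ_n, M)|_θ)` and layer
  classes `b_i ∈ H¹(U_n, M|)` with `H¹(Φ_{g_iΓ_n}) u = Sh^{Γ_v}_{U_n}(b_i)` (the place components of `u`):
  `inv_v(θ^*(Sh_{Γ_n} a) ∪_{Σe|θ} u) = Σ_i layerPairingH1Of … n (layerLocOf (g_i · a)) (b_i)` — the generic orbit splitting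
  `cupProduct_map_shapiroLift_eq_sum_orbits` (`GaloisRepresentations/ContinuousShapiroLiftMackeyH1.lean` §4) READ in the layer-pairing
  currency (`layerLocOf`, `layerShapiroOf`, `layerSumPairingOf`, `layerPairingH1Of`, all definitionally the generic Shapiro objects for `θ`).
  The companion's `invAt_localization_cupProduct_shapiroLift_eq_sum` is the case `u = θ^*(Sh_{Γ_n} b)`, `b_i = loc_n(g_i · b)`.
* **`exists_local_forall_invAt_cupProduct_eq_sum`** — PRESCRIBED place components: for every tuple `b : ι → H¹(U_n, M|)` there is
  `u ∈ H¹(Γ_v, Maps(Γ_ℚ ⧸ Γ_n, M)|_θ)` with `H¹(Φ_{g_iΓ_n}) u = Sh(b_i)` for all `i` (H¹-Mackey joint surjectivity,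
  `exists_cohomologyMap_resCoindFinHomR_eq_shapiroLift`), hence `inv_v(θ^*(Sh a) ∪ u) = Σ_i ⟨loc_n(g_i · a), b_i⟩` for EVERY `a`.

Consumer: the deep-half stub `stub_deepHalfAwayTwo` (S4₀) of crux RSL_g `ResidualSignedLambdaLowerCMAtTwo` (`Summits/BirchSwinnertonDyer`;
STUB-PLAN rev 16 S66 N3/Q69 and Q68): the ONE `SelmerComplement` call per level needs, at each `ℓ ∈ S₀`, a LOCAL class with prescribed
components at the places of `ℚ_n` above `ℓ`, and its Poitou–Tate local term against the restricted global Shapiro lifts must be the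
`S₀`-block sum of the layer pairings — exactly the two statements here. Nothing about BSD is proved.

References: [Brown1982] III §5 (5.6)(b), III §6 (6.5); [NeukirchSchmidtWingberg2008] I §5 Prop. (1.5.3) (iv), (1.5.6)–(1.5.7), I §6 Prop.
(1.6.4)–(1.6.5); [Kobayashi2003] (8.23) (p. 18); [MilneADT2006] I §6 (proof of Prop. 6.9).
-/

set_option autoImplicit false

noncomputable section

open scoped Classical

namespace Literature.NumberTheory.EllipticCurves

namespace CyclotomicLayer

open CategoryTheory Field NumberField IsDedekindDomain
  Literature.NumberTheory.GaloisRepresentations Literature.NumberTheory.GaloisCohomology ZpExtension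
open Literature.NumberTheory.GaloisRepresentations.DiscreteGaloisModule (mu MuCarrier)

-- Cup products need `LocallyCompactSpace Γ`: the (Prop-valued) compactness of the two absolute Galois groups is taken as an INSTANCE
-- BINDER of each statement (supply `absoluteGaloisGroup_compactSpace _`); no local instance attribute.

universe w

variable {M : Type} [AddCommGroup M] [TopologicalSpace M] [DiscreteTopology M]
  (ρM : DiscreteGaloisModule ℚ M) (N : ℕ) [NeZero N]
  (e : M → M → AlgebraicClosure ℚ)
  (hμ : ∀ S T, e S T ^ N = 1)
  (hadd₁ : ∀ S₁ S₂ T, e (S₁ + S₂) T = e S₁ T * e S₂ T)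
  (hadd₂ : ∀ S T₁ T₂, e S (T₁ + T₂) = e S T₁ * e S T₂)
  (hgal : ∀ (σ : absoluteGaloisGroup ℚ) (S T : M), σ • e S T = e (ρM σ S) (ρM σ T))
  {p : ℕ} [Fact p.Prime] (κ : ZpExtension ℚ p) (v : HeightOneSpectrum (𝓞 ℚ)) (n : ℕ)

/-- **`inv_v(θ^*(Sh_{Γ_n} a) ∪_{Σe} u) = Σ_i ⟨loc_n(g_i · a), b_i⟩_{n,N,v}` for an ARBITRARY local second factor**: for `a ∈ H¹(Γ_n, M)`,
`u ∈ H¹(Γ_v, Maps(Γ_ℚ ⧸ Γ_n, M)|_θ)` and layer classes `b_i ∈ H¹(U_n, M|)` with `H¹(Φ_{g_iΓ_n}) u = Sh^{Γ_v}_{U_n}(b_i)`, the local invariant of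
the `Γ_v`-cup product of the restricted global Shapiro lift `θ^*(Sh a)` with `u` is the ORBIT SUM of the layer pairings (`layerPairingH1Of`)
of the conjugates `g_i · a` against the `b_i` (orbit splitting `cupProduct_map_shapiroLift_eq_sum_orbits` read in the layer currency).
[cite: NeukirchSchmidtWingberg2008, I §5 Prop. (1.5.3) (iv), (1.5.6)–(1.5.7), I §6 Prop. (1.6.5)] [cite: Kobayashi2003, (8.23) (p. 18)]
[cite: Brown1982, III §5 (5.6)(b)] -/
theorem invAt_cupProduct_map_shapiroLift_eq_sum [CompactSpace (absoluteGaloisGroup ℚ)]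
    [CompactSpace (absoluteGaloisGroup (v.adicCompletion ℚ))] [Fintype (absoluteGaloisGroup ℚ ⧸ κ.layerSubgroup n)]
    {s : absoluteGaloisGroup ℚ ⧸ κ.layerSubgroup n → absoluteGaloisGroup ℚ}
    (hs : ∀ y, (s y : absoluteGaloisGroup ℚ ⧸ κ.layerSubgroup n) = y)
    (hs1 : s ((1 : absoluteGaloisGroup ℚ) : absoluteGaloisGroup ℚ ⧸ κ.layerSubgroup n) = 1)
    {ι : Type w} [Fintype ι] (g : ι → absoluteGaloisGroup ℚ)
    (hbij : Function.Bijective fun q : ι × (absoluteGaloisGroup (v.adicCompletion ℚ) ⧸ layerGroup κ v n) =>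
      quotientMapOfHom (κ.layerSubgroup n) (resGalOfEmb (closureEmb (K := ℚ) (v.adicCompletion ℚ))) q.2 *
        (g q.1 : absoluteGaloisGroup ℚ ⧸ κ.layerSubgroup n))
    (a : H1 ρM (κ.layerSubgroup n))
    (u : continuousCohomology 1 (TopRep.res (resGalOfEmb (closureEmb (K := ℚ) (v.adicCompletion ℚ)) :
      absoluteGaloisGroup (v.adicCompletion ℚ) →* absoluteGaloisGroup ℚ) (coindFin ρM.toTopRep (κ.layerSubgroup n))))
    (b : ι → continuousCohomology 1 (subgroupRep (localRepOf ρM v) (layerGroup κ v n)))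
    (hb : ∀ i, cohomologyMap (resCoindFinHomR ρM.toTopRep (κ.layerSubgroup n) (resGalOfEmb (closureEmb (K := ℚ) (v.adicCompletion ℚ)))
        (g i : absoluteGaloisGroup ℚ ⧸ κ.layerSubgroup n)) 1 u = layerShapiroOf ρM κ v n (b i)) :
    invAt N v
        ((((contPairingOfFun ρM N e hμ hadd₁ hadd₂ hgal).coindFin (κ.layerSubgroup n)).restrict
            (resGalOfEmb (closureEmb (K := ℚ) (v.adicCompletion ℚ)))).cupProduct
          (ContinuousCohomology.map (resGalOfEmb (closureEmb (K := ℚ) (v.adicCompletion ℚ)))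
            (𝟙 (TopRep.res (resGalOfEmb (closureEmb (K := ℚ) (v.adicCompletion ℚ)) :
              absoluteGaloisGroup (v.adicCompletion ℚ) →* absoluteGaloisGroup ℚ) (coindFin ρM.toTopRep (κ.layerSubgroup n)))) 1
            (shapiroLift ρM.toTopRep (κ.layerSubgroup n) (κ.isOpen_layerSubgroup n) hs hs1 a)) u) =
      ∑ i, layerPairingH1Of ρM N e hμ hadd₁ hadd₂ hgal κ v n
        (layerLocOf ρM κ v n (conjMap ρM.toTopRep (κ.layerSubgroup n) (g i) 1 a)) (b i) := by
  letI : Fintype (absoluteGaloisGroup (v.adicCompletion ℚ) ⧸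
      (κ.layerSubgroup n).comap ((resGalOfEmb (closureEmb (K := ℚ) (v.adicCompletion ℚ)) :
        absoluteGaloisGroup (v.adicCompletion ℚ) →* absoluteGaloisGroup ℚ))) :=
    layerFintypeQuot κ v n
  -- the generic orbit splitting, READ in the layer currency (definitional: `layerSumPairingOf`, `layerShapiroOf ∘ layerLocOf`)
  have h : (((contPairingOfFun ρM N e hμ hadd₁ hadd₂ hgal).coindFin (κ.layerSubgroup n)).restrict
        (resGalOfEmb (closureEmb (K := ℚ) (v.adicCompletion ℚ)))).cupProduct
      (ContinuousCohomology.map (resGalOfEmb (closureEmb (K := ℚ) (v.adicCompletion ℚ)))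
        (𝟙 (TopRep.res (resGalOfEmb (closureEmb (K := ℚ) (v.adicCompletion ℚ)) :
          absoluteGaloisGroup (v.adicCompletion ℚ) →* absoluteGaloisGroup ℚ) (coindFin ρM.toTopRep (κ.layerSubgroup n)))) 1
        (shapiroLift ρM.toTopRep (κ.layerSubgroup n) (κ.isOpen_layerSubgroup n) hs hs1 a)) u =
      ∑ i, (layerSumPairingOf ρM N e hμ hadd₁ hadd₂ hgal κ v n).cupProduct
        (layerShapiroOf ρM κ v n (layerLocOf ρM κ v n (conjMap ρM.toTopRep (κ.layerSubgroup n) (g i) 1 a)))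
        (layerShapiroOf ρM κ v n (b i)) := by
    refine (cupProduct_map_shapiroLift_eq_sum_orbits (contPairingOfFun ρM N e hμ hadd₁ hadd₂ hgal) (κ.layerSubgroup n)
      (resGalOfEmb (closureEmb (K := ℚ) (v.adicCompletion ℚ))) (κ.isOpen_layerSubgroup n) g hbij hs hs1
      (layerReps_spec κ v n) (layerReps_one κ v n) a u).trans (Finset.sum_congr rfl fun i _ => ?_)
    calc _ = (layerSumPairingOf ρM N e hμ hadd₁ hadd₂ hgal κ v n).cupProduct
          (layerShapiroOf ρM κ v n (layerLocOf ρM κ v n (conjMap ρM.toTopRep (κ.layerSubgroup n) (g i) 1 a)))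
          (cohomologyMap (resCoindFinHomR ρM.toTopRep (κ.layerSubgroup n) (resGalOfEmb (closureEmb (K := ℚ) (v.adicCompletion ℚ)))
            (g i : absoluteGaloisGroup ℚ ⧸ κ.layerSubgroup n)) 1 u) := rfl
      _ = _ := by rw [hb i]
  have h' := congrArg (invAt N v) h
  rw [map_sum] at h'
  exact h'

/-- **Local classes with PRESCRIBED place components, and their local term**: for every tuple of layer classes `b : ι → H¹(U_n, M|)`
(one per place of `ℚ_n` above `v`) there is a LOCAL class `u ∈ H¹(Γ_v, Maps(Γ_ℚ ⧸ Γ_n, M)|_θ)` whose place components are the `b_i`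
(`H¹(Φ_{g_iΓ_n}) u = Sh(b_i)`, H¹-Mackey joint surjectivity `exists_cohomologyMap_resCoindFinHomR_eq_shapiroLift`), and then
`inv_v(θ^*(Sh_{Γ_n} a) ∪_{Σe} u) = Σ_i ⟨loc_n(g_i · a), b_i⟩_{n,N,v}` for EVERY `a ∈ H¹(Γ_n, M)`.
[cite: Brown1982, III §5 (5.6)(b) and III §6 (6.5)] [cite: NeukirchSchmidtWingberg2008, I §5 Prop. (1.5.3) (iv), I §6 Prop. (1.6.4)–(1.6.5)]
[cite: Kobayashi2003, (8.23) (p. 18)] -/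
theorem exists_local_forall_invAt_cupProduct_eq_sum [CompactSpace (absoluteGaloisGroup ℚ)]
    [CompactSpace (absoluteGaloisGroup (v.adicCompletion ℚ))] [Fintype (absoluteGaloisGroup ℚ ⧸ κ.layerSubgroup n)]
    {s : absoluteGaloisGroup ℚ ⧸ κ.layerSubgroup n → absoluteGaloisGroup ℚ}
    (hs : ∀ y, (s y : absoluteGaloisGroup ℚ ⧸ κ.layerSubgroup n) = y)
    (hs1 : s ((1 : absoluteGaloisGroup ℚ) : absoluteGaloisGroup ℚ ⧸ κ.layerSubgroup n) = 1)
    {ι : Type} [Fintype ι] (g : ι → absoluteGaloisGroup ℚ)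
    (hbij : Function.Bijective fun q : ι × (absoluteGaloisGroup (v.adicCompletion ℚ) ⧸ layerGroup κ v n) =>
      quotientMapOfHom (κ.layerSubgroup n) (resGalOfEmb (closureEmb (K := ℚ) (v.adicCompletion ℚ))) q.2 *
        (g q.1 : absoluteGaloisGroup ℚ ⧸ κ.layerSubgroup n))
    (b : ι → continuousCohomology 1 (subgroupRep (localRepOf ρM v) (layerGroup κ v n))) :
    ∃ u : continuousCohomology 1 (TopRep.res (resGalOfEmb (closureEmb (K := ℚ) (v.adicCompletion ℚ)) :
        absoluteGaloisGroup (v.adicCompletion ℚ) →* absoluteGaloisGroup ℚ) (coindFin ρM.toTopRep (κ.layerSubgroup n))),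
      (∀ i, cohomologyMap (resCoindFinHomR ρM.toTopRep (κ.layerSubgroup n) (resGalOfEmb (closureEmb (K := ℚ) (v.adicCompletion ℚ)))
          (g i : absoluteGaloisGroup ℚ ⧸ κ.layerSubgroup n)) 1 u = layerShapiroOf ρM κ v n (b i)) ∧
      ∀ a : H1 ρM (κ.layerSubgroup n),
        invAt N v
            ((((contPairingOfFun ρM N e hμ hadd₁ hadd₂ hgal).coindFin (κ.layerSubgroup n)).restrict
                (resGalOfEmb (closureEmb (K := ℚ) (v.adicCompletion ℚ)))).cupProduct
              (ContinuousCohomology.map (resGalOfEmb (closureEmb (K := ℚ) (v.adicCompletion ℚ)))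
                (𝟙 (TopRep.res (resGalOfEmb (closureEmb (K := ℚ) (v.adicCompletion ℚ)) :
                  absoluteGaloisGroup (v.adicCompletion ℚ) →* absoluteGaloisGroup ℚ) (coindFin ρM.toTopRep (κ.layerSubgroup n)))) 1
                (shapiroLift ρM.toTopRep (κ.layerSubgroup n) (κ.isOpen_layerSubgroup n) hs hs1 a)) u) =
          ∑ i, layerPairingH1Of ρM N e hμ hadd₁ hadd₂ hgal κ v n
            (layerLocOf ρM κ v n (conjMap ρM.toTopRep (κ.layerSubgroup n) (g i) 1 a)) (b i) := by
  obtain ⟨u, hu⟩ := exists_cohomologyMap_resCoindFinHomR_eq_shapiroLift ρM.toTopRep (κ.layerSubgroup n)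
    (resGalOfEmb (closureEmb (K := ℚ) (v.adicCompletion ℚ))) (κ.isOpen_layerSubgroup n) g hbij
    (layerReps_spec κ v n) (layerReps_one κ v n) b
  exact ⟨u, hu, fun a => invAt_cupProduct_map_shapiroLift_eq_sum ρM N e hμ hadd₁ hadd₂ hgal κ v n hs hs1 g hbij a u b hu⟩

end CyclotomicLayer

end Literature.NumberTheory.EllipticCurves

end
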